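import Literature.AlgebraicGeometry.Modules.CechBaseChangeHom
import Mathlib.AlgebraicGeometry.Morphisms.Flat
import Mathlib.Algebra.Category.Ring.Constructions
import HarnessLib

/-!
# Base change of Čech complexes along a cartesian square: `q^* g₀_* Č•(𝓤, N₀) ≅ g'_* Č•(π'⁻¹𝓤, π'^*N₀)`
# for a finite cover with faces affine over the base (Hartshorne III Prop. 9.3, proof; Stacks 02KG, 02KH)

Layer `Literature/AlgebraicGeometry/Modules`. For a cartesian square `g' ≫ q = π' ≫ g₀` of schemes
(`hsq : IsPullback g' π' q g₀`, `Z' = P ×_Y Z₀`), a FINITE family `𝓤` of opens of `Z₀` whose faces are affine over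
`Y` (`IsAffineHom ((face U β).ι ≫ g₀)`) and an affine-localizing (e.g. quasi-coherent) `𝒪_{Z₀}`-module `N₀`,
the comparison `θⁿ : q^* g₀_* Čⁿ(𝓤, N₀) ⟶ g'_* Čⁿ(π'⁻¹𝓤, π'^*N₀)` of `Modules/CechBaseChangeHom` is an
ISOMORPHISM (`isIso_baseChangeHom`), hence so is the comparison of Čech complexes
(**`baseChangeComplexIso`**). No flatness and no affineness of `q` is needed here (Stacks 02KG: affine base
change for the affine pieces `g₀⁻¹V ∩ U_α → V` holds for ANY base change); flatness of `q` enters flat base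
change (Hartshorne III 9.3, `Modules/DerivedFlatBaseChange`) only through the exactness of `q^*`.

Proof (`baseChangeHom_app_bijective`): on an affine `W ⊆ q⁻¹V`, `V ⊆ Y` affine, with `A = Γ(V)`, `B = Γ(W)`,
`A_α = Γ(g₀⁻¹V ∩ U_α)`, `B_α = Γ(g'⁻¹W ∩ U'_α) = B ⊗_A A_α` (Mathlib `isIso_pushoutSection_of_isAffineOpen`):
`Γ(W, q^* g₀_* Čⁿ) = B ⊗_A Π_α Γ(N₀, g₀⁻¹V ∩ U_α)` (`isBaseChange_unitSectionLE`, `g₀_* Čⁿ` being affine-localizing by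
`Cech.isAffineLocalizing_pushforward_obj`) and `Γ(W, g'_* Čⁿ(𝓤', π'^*N₀)) = Π_α Γ(g'⁻¹W ∩ U'_α, π'^*N₀) =
Π_α B_α ⊗_{A_α} N_α = Π_α B ⊗_A N_α = B ⊗_A Π_α N_α` (`isBaseChange_unitSectionLE` for `π'`,
`isBaseChange_of_isPushout`, `IsBaseChange.pi` — finiteness of `𝓤`), and `θⁿ` is `B`-linear and compatible with
the structure maps (`baseChangeHom_app_unitSectionLE`), hence bijective (`bijective_of_isBaseChange`); bijective on
the basis of such `W` ⇒ isomorphism (`isIso_of_bijective_on_basis`).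

Everything PROVED; 0 named facts; no instances. Typed for the cell `pub-hodge-ring2` (brick (K4) «derived flat base
change»); a research route conditional on HC_CM, not a corollary — nothing in this file refers to it.

## References

* R. Hartshorne, *Algebraic Geometry*, GTM 52 (1977), III Prop. 9.3 (proof). [Hartshorne1977]
* The Stacks Project, Tags 02KG (affine base change), 02KH (flat base change), 02KE. [StacksProject]
-/

noncomputable section

-- `TopCat.Presheaf`/`Scheme.Modules` are not reducible (as in Mathlib's `AlgebraicGeometry/Modules/Sheaf.lean`).
set_option backward.isDefEq.respectTransparency false

universe u

open CategoryTheory CategoryTheory.Limits Opposite TopologicalSpace AlgebraicGeometry TensorProduct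

namespace Literature.AlgebraicGeometry.Modules

section BaseChange

variable {Z₀ Z' P Y : Scheme.{u}} {g₀ : Z₀ ⟶ Y} {q : P ⟶ Y} {π' : Z' ⟶ Z₀} {g' : Z' ⟶ P}
  (hsq : IsPullback g' π' q g₀) {ι : Type u} [Finite ι] (U : ι → Z₀.Opens)
  (hUaff : ∀ {m : ℕ} (β : Fin (m + 1) → ι), IsAffineHom ((face U β).ι ≫ g₀))
  {N₀ : Z₀.Modules} (hN₀ : IsAffineLocalizing N₀) (n : ℕ)
include hsq hUaff hN₀

omit [Finite ι] hUaff hN₀ in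
/-- `g'⁻¹W ∩ U'_α = g'⁻¹W ∩ π'⁻¹(g₀⁻¹V ∩ U_α)` for `W ≤ q⁻¹V` (the shape of Mathlib's `pushoutSection`).
[cite: Hartshorne1977, III Prop. 9.3 (proof)] -/
theorem preimage_inf_face_eq {V : Y.Opens} {W : P.Opens} (i : W ≤ q ⁻¹ᵁ V) {m : ℕ} (α : Fin (m + 1) → ι) :
    g' ⁻¹ᵁ W ⊓ face (Cech.preimageFamily π' U) α = g' ⁻¹ᵁ W ⊓ π' ⁻¹ᵁ (g₀ ⁻¹ᵁ V ⊓ face U α) := by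
  have hle : g' ⁻¹ᵁ W ≤ π' ⁻¹ᵁ (g₀ ⁻¹ᵁ V) := by
    refine (g'.preimage_mono i).trans (le_of_eq ?_)
    rw [← Scheme.Hom.comp_preimage, ← Scheme.Hom.comp_preimage, hsq.w]
  rw [Cech.face_preimageFamily, Scheme.Hom.preimage_inf, ← inf_assoc, inf_eq_left.mpr hle]

/-- **`θⁿ` is bijective on sections over an affine `W ⊆ q⁻¹V` (`V` affine)**: both sides are the base change
`Γ(W) ⊗_{Γ(V)} Π_α Γ(N₀, g₀⁻¹V ∩ U_α)`. [cite: Hartshorne1977, III Prop. 9.3 (proof)] [cite: StacksProject, Tag 02KG] -/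
theorem baseChangeHom_app_bijective {V : Y.Opens} (hV : IsAffineOpen V) {W : P.Opens} (hW : IsAffineOpen W)
    (i : W ≤ q ⁻¹ᵁ V) : Function.Bijective ((baseChangeHom hsq U N₀ n).app W) := by
  classical
  haveI : Fintype (Fin (n + 1) → ι) := Fintype.ofFinite _
  -- the opens
  let U' := Cech.preimageFamily π' U
  let O : (Fin (n + 1) → ι) → Z₀.Opens := fun α => g₀ ⁻¹ᵁ V ⊓ face U α
  let W' : (Fin (n + 1) → ι) → Z'.Opens := fun α => g' ⁻¹ᵁ W ⊓ face U' α
  have hO : ∀ α, IsAffineOpen (O α) := fun α => isAffineOpen_preimage_inf_face U g₀ hUaff hV α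
  have hUaff' : ∀ {m : ℕ} (β : Fin (m + 1) → ι), IsAffineHom ((face U' β).ι ≫ g') := fun β =>
    isAffineHom_face_preimageFamily_ι_comp hsq U hUaff β
  have hW' : ∀ α, IsAffineOpen (W' α) := fun α => isAffineOpen_preimage_inf_face U' g' hUaff' hW α
  have iα : ∀ α, W' α ≤ π' ⁻¹ᵁ O α := fun α => preimage_inf_face_le hsq U i α
  have hOV : ∀ α, O α ≤ g₀ ⁻¹ᵁ V := fun α => inf_le_left
  have hW'W : ∀ α, W' α ≤ g' ⁻¹ᵁ W := fun α => inf_le_left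
  have hW'eq : ∀ α, W' α = g' ⁻¹ᵁ W ⊓ π' ⁻¹ᵁ O α := fun α => preimage_inf_face_eq hsq U i α
  -- the Čech sheaves
  let F : Y.Modules := (Scheme.Modules.pushforward g₀).obj (Cech.obj U n N₀)
  have hF : IsAffineLocalizing F := Cech.isAffineLocalizing_pushforward_obj g₀ U n hUaff hN₀
  let M' : Z'.Modules := (Scheme.Modules.pullback π').obj N₀
  let C' : Z'.Modules := Cech.obj U' n M'
  -- the cocartesian squares of rings of sections `Γ(W'_α) = Γ(W) ⊗_{Γ(V)} Γ(O_α)`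
  have PX : ∀ α, IsPushout (q.appLE V W i) (g₀.appLE V (O α) (hOV α)) (g'.appLE W (W' α) (hW'W α))
      (π'.appLE (O α) (W' α) (iα α)) := fun α =>
    (isIso_pushoutSection_iff hsq (hOV α) i (hW'eq α)).mp
      (isIso_pushoutSection_of_isAffineOpen hsq (hOV α) i (hW'eq α) hV (hO α) hW)
  -- algebra structures
  letI algAB : Algebra Γ(Y, V) Γ(P, W) := (q.appLE V W i).hom.toAlgebra
  letI algAAα : ∀ α, Algebra Γ(Y, V) Γ(Z₀, O α) := fun α => (g₀.appLE V (O α) (hOV α)).hom.toAlgebra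
  letI algBBα : ∀ α, Algebra Γ(P, W) Γ(Z', W' α) := fun α => (g'.appLE W (W' α) (hW'W α)).hom.toAlgebra
  letI algAαBα : ∀ α, Algebra Γ(Z₀, O α) Γ(Z', W' α) := fun α => (π'.appLE (O α) (W' α) (iα α)).hom.toAlgebra
  letI algABα : ∀ α, Algebra Γ(Y, V) Γ(Z', W' α) := fun α =>
    ((algebraMap Γ(P, W) Γ(Z', W' α)).comp (algebraMap Γ(Y, V) Γ(P, W))).toAlgebra
  haveI towerABBα : ∀ α, IsScalarTower Γ(Y, V) Γ(P, W) Γ(Z', W' α) := fun α => IsScalarTower.of_algebraMap_eq' rfl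
  have hcomm : ∀ α (c : Γ(Y, V)), π'.appLE (O α) (W' α) (iα α) (g₀.appLE V (O α) (hOV α) c) =
      g'.appLE W (W' α) (hW'W α) (q.appLE V W i c) := fun α c => (ConcreteCategory.congr_hom (PX α).w c).symm
  haveI towerAAαBα : ∀ α, IsScalarTower Γ(Y, V) Γ(Z₀, O α) Γ(Z', W' α) := fun α =>
    IsScalarTower.of_algebraMap_eq' (RingHom.ext fun c => (hcomm α c).symm)
  have hP : ∀ α, Algebra.IsPushout Γ(Y, V) Γ(P, W) Γ(Z₀, O α) Γ(Z', W' α) := fun α =>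
    CommRingCat.isPushout_iff_isPushout.mp (PX α)
  -- module structures
  letI modAS : Module Γ(Y, V) Γ((Scheme.Modules.pullback q).obj F, W) := Module.compHom _ (q.appLE V W i).hom
  haveI : IsScalarTower Γ(Y, V) Γ(P, W) Γ((Scheme.Modules.pullback q).obj F, W) :=
    ⟨fun a b x => mul_smul ((q.appLE V W i).hom a) b x⟩
  letI modAN : ∀ α, Module Γ(Y, V) Γ(N₀, O α) := fun α => Module.compHom _ (g₀.appLE V (O α) (hOV α)).hom
  haveI : ∀ α, IsScalarTower Γ(Y, V) Γ(Z₀, O α) Γ(N₀, O α) := fun α =>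
    ⟨fun a b x => mul_smul ((g₀.appLE V (O α) (hOV α)).hom a) b x⟩
  letI modAαT : ∀ α, Module Γ(Z₀, O α) Γ(M', W' α) := fun α => Module.compHom _ (π'.appLE (O α) (W' α) (iα α)).hom
  haveI : ∀ α, IsScalarTower Γ(Z₀, O α) Γ(Z', W' α) Γ(M', W' α) := fun α =>
    ⟨fun a b x => mul_smul ((π'.appLE (O α) (W' α) (iα α)).hom a) b x⟩
  letI modBT : ∀ α, Module Γ(P, W) Γ(M', W' α) := fun α => Module.compHom _ (g'.appLE W (W' α) (hW'W α)).hom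
  haveI : ∀ α, IsScalarTower Γ(P, W) Γ(Z', W' α) Γ(M', W' α) := fun α =>
    ⟨fun a b x => mul_smul ((g'.appLE W (W' α) (hW'W α)).hom a) b x⟩
  letI modAT : ∀ α, Module Γ(Y, V) Γ(M', W' α) := fun α => Module.compHom _ (algebraMap Γ(Y, V) Γ(Z', W' α))
  haveI : ∀ α, IsScalarTower Γ(Y, V) Γ(Z', W' α) Γ(M', W' α) := fun α =>
    ⟨fun a b x => mul_smul (algebraMap Γ(Y, V) Γ(Z', W' α) a) b x⟩
  haveI : ∀ α, IsScalarTower Γ(Y, V) Γ(P, W) Γ(M', W' α) := fun α =>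
    ⟨fun a b x => by
      change algebraMap Γ(P, W) Γ(Z', W' α) ((q.appLE V W i).hom a * b) • x =
        algebraMap Γ(Y, V) Γ(Z', W' α) a • (algebraMap Γ(P, W) Γ(Z', W' α) b • x)
      rw [map_mul, mul_smul]; rfl⟩
  haveI : ∀ α, IsScalarTower Γ(Y, V) Γ(Z₀, O α) Γ(M', W' α) := fun α =>
    ⟨fun a b x => by
      change (π'.appLE (O α) (W' α) (iα α)) ((g₀.appLE V (O α) (hOV α)) a * b) • x =
        algebraMap Γ(Y, V) Γ(Z', W' α) a • ((π'.appLE (O α) (W' α) (iα α)) b • x)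
      rw [map_mul, mul_smul, hcomm α a]; rfl⟩
  -- (1) `Γ(W, q^* F)` is the base change of `Γ(V, F)`
  have h₁ : IsBaseChange Γ(P, W) (unitSectionLEₗ q F i) := isBaseChange_unitSectionLE q F i hV hW hF
  -- (2) `Π_α Γ(W'_α, π'^*N₀)` is the base change of `Π_α Γ(O_α, N₀)`
  have hα : ∀ α, IsBaseChange Γ(P, W) ((unitSectionLEₗ π' N₀ (iα α)).restrictScalars Γ(Y, V)) := fun α =>
    isBaseChange_of_isPushout (unitSectionLEₗ π' N₀ (iα α))
      (isBaseChange_unitSectionLE π' N₀ (iα α) (hO α) (hW' α) hN₀)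
  have hpi := IsBaseChange.pi (S := Γ(P, W))
    (fun α => (unitSectionLEₗ π' N₀ (iα α)).restrictScalars Γ(Y, V)) hα
  -- the identity equivalences with the products
  let eM : Γ(F, V) ≃ₗ[Γ(Y, V)] (∀ α, Γ(N₀, O α)) :=
    { toFun := fun m => (show Γ(Cech.obj U n N₀, g₀ ⁻¹ᵁ V) from m : Cech.Sections U n N₀ (g₀ ⁻¹ᵁ V))
      invFun := fun s => (show Γ(Cech.obj U n N₀, g₀ ⁻¹ᵁ V) from (s : Cech.Sections U n N₀ (g₀ ⁻¹ᵁ V)))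
      left_inv := fun _ => rfl
      right_inv := fun _ => rfl
      map_add' := fun _ _ => rfl
      map_smul' := fun a m => funext fun α => by
        rw [pushforward_smul g₀, RingHom.id_apply]
        rw [Cech.obj_smul_apply]
        rfl }
  let eT : Γ((Scheme.Modules.pushforward g').obj C', W) ≃ₗ[Γ(P, W)] (∀ α, Γ(M', W' α)) :=
    { toFun := fun t => (show Γ(C', g' ⁻¹ᵁ W) from t : Cech.Sections U' n M' (g' ⁻¹ᵁ W))
      invFun := fun s => (show Γ(C', g' ⁻¹ᵁ W) from (s : Cech.Sections U' n M' (g' ⁻¹ᵁ W)))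
      left_inv := fun _ => rfl
      right_inv := fun _ => rfl
      map_add' := fun _ _ => rfl
      map_smul' := fun b t => funext fun α => by
        rw [pushforward_smul g', RingHom.id_apply]
        rw [Cech.obj_smul_apply]
        rfl }
  have h₂ : IsBaseChange Γ(P, W)
      ((LinearMap.pi fun α => (unitSectionLEₗ π' N₀ (iα α)).restrictScalars Γ(Y, V) ∘ₗ LinearMap.proj α) ∘ₗ
        eM.toLinearMap) := IsBaseChange.comp_equiv eM _ hpi
  -- `θ` as a `Γ(W)`-linear map into the product
  let θB : Γ((Scheme.Modules.pullback q).obj F, W) →ₗ[Γ(P, W)] Γ((Scheme.Modules.pushforward g').obj C', W) :=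
    { toFun := (baseChangeHom hsq U N₀ n).app W
      map_add' := fun x y => map_add _ x y
      map_smul' := fun b x => Scheme.Modules.Hom.app_smul _ b x }
  have hbij := bijective_of_isBaseChange (B := Γ(P, W)) (unitSectionLEₗ q F i)
    ((LinearMap.pi fun α => (unitSectionLEₗ π' N₀ (iα α)).restrictScalars Γ(Y, V) ∘ₗ LinearMap.proj α) ∘ₗ
      eM.toLinearMap) h₁ h₂ (eT.toLinearMap ∘ₗ θB) fun m => funext fun α =>
        baseChangeHom_app_unitSectionLE hsq U N₀ n i m α
  exact (eT.bijective.of_comp_iff' ((baseChangeHom hsq U N₀ n).app W)).mp hbij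

/-- **`θⁿ : q^* g₀_* Čⁿ(𝓤, N₀) ⟶ g'_* Čⁿ(π'⁻¹𝓤, π'^*N₀)` is an isomorphism** (finite `𝓤` with faces affine over
`Y`, `N₀` affine-localizing; bijective on the basis of affine `W ⊆ q⁻¹V`). [cite: Hartshorne1977, III Prop. 9.3 (proof)]
[cite: StacksProject, Tags 02KG and 02KH] -/
theorem isIso_baseChangeHom : IsIso (baseChangeHom hsq U N₀ n) :=
  isIso_of_bijective_on_basis _ (isBasis_affineOpens_le_preimage q) fun _ hW =>
    match hW with
    | ⟨hW, _, hV, i⟩ => baseChangeHom_app_bijective hsq U hUaff hN₀ n hV hW i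

/-- **`q^* g₀_* Čⁿ(𝓤, N₀) ≅ g'_* Čⁿ(π'⁻¹𝓤, π'^*N₀)`.** [cite: Hartshorne1977, III Prop. 9.3 (proof)] [cite: StacksProject, Tag 02KH] -/
def baseChangeIso :
    (Scheme.Modules.pullback q).obj ((Scheme.Modules.pushforward g₀).obj (Cech.obj U n N₀)) ≅
      (Scheme.Modules.pushforward g').obj
        (Cech.obj (Cech.preimageFamily π' U) n ((Scheme.Modules.pullback π').obj N₀)) :=
  haveI := isIso_baseChangeHom hsq U hUaff hN₀ n
  asIso (baseChangeHom hsq U N₀ n)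

/-- **`q^* g₀_* Č•(𝓤, N₀) ≅ g'_* Č•(π'⁻¹𝓤, π'^*N₀)` as cochain complexes.** [cite: Hartshorne1977, III Prop. 9.3 (proof)]
[cite: StacksProject, Tag 02KH] -/
def baseChangeComplexIso :
    ((Scheme.Modules.pushforward g₀ ⋙ Scheme.Modules.pullback q).mapHomologicalComplex (ComplexShape.up ℕ)).obj
        (Cech.complex U N₀) ≅
      ((Scheme.Modules.pushforward g').mapHomologicalComplex (ComplexShape.up ℕ)).obj
        (Cech.complex (Cech.preimageFamily π' U) ((Scheme.Modules.pullback π').obj N₀)) :=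
  haveI : ∀ k, IsIso ((baseChangeComplexHom hsq U N₀).f k) := fun k => isIso_baseChangeHom hsq U hUaff hN₀ k
  haveI := HomologicalComplex.Hom.isIso_of_components (baseChangeComplexHom hsq U N₀)
  asIso (baseChangeComplexHom hsq U N₀)

/-- Components of `baseChangeComplexIso`. [cite: Hartshorne1977, III Prop. 9.3 (proof)] -/
@[simp] theorem baseChangeComplexIso_hom_f (k : ℕ) :
    (baseChangeComplexIso hsq U hUaff hN₀).hom.f k = baseChangeHom hsq U N₀ k := rfl

end BaseChange

end Literature.AlgebraicGeometry.Modules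

end
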